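import Summits.AtomisticToContinuum.HydrodynamicLimit.Theorems.StiffCollisionalRelaxationAprioriBoundsFibreDefs
import Summits.AtomisticToContinuum.HydrodynamicLimit.Theorems.AntiMazurCoboundariesShearStressHalfDrudeRelabel
import Summits.AtomisticToContinuum.HydrodynamicLimit.Theorems.StiffCollisionalRelaxationAprioriBoundsMesoVarianceTimeZero
import HarnessLib

/-!
# Poisson-order variance of the kernel block density ⟺ pair-correlation bound (exchangeability glue: stub
# `stub_mesoVariance_of_pairCorrelation`, line `meso-chebyshev-window`, crux `StiffCollisionalRelaxation.AprioriBounds`,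
# stmt-AtomisticToContinuum-14827)

Helper file (`--supports stmt-AtomisticToContinuum-14827`) landing registered stub 4 of the r3 skeleton of the line.
Component (ii) of the crux is closed (landed Chebyshev-window glue) from a mean floor, a mean ceiling and a POISSON-ORDER
VARIANCE `Var_{P_N} ρ̄_φ(s,x) ≤ A (N+1)^{3γ−1}` of the kernel block density
`ρ̄_φ(s,x)(z) = empiricalDensityField ((Φ N).flow s z) (fun y => φ_N (y − x)) = (N+1)⁻¹ ∑ᵢ gᵢ(z)`,
`gᵢ(z) = φ_N(((Φ N).flow s z i).1 − x)`, `0 ≤ gᵢ ≤ C (N+1)^{3γ}`, under `P_N = localGibbsLaw σ a₀ u₀ θ₀ N (Φ N)`.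

* EXCHANGEABILITY of the evolved law (two-time exchangeability of the local Gibbs law jointly with the flow,
  `ShearStressHalfDrudeRelabel.integral_twoTime_comp_perm_localGibbsLaw`, for functionals of the evolved configuration):
  `E gᵢ = E g₀`, `Cov(gᵢ, gᵢ) = Var g₀`, `Cov(gᵢ, gⱼ) = Cov(g₀, g₁)` (`i ≠ j`) (§1).
* The EXACT identity `Var ρ̄ = (N+1)⁻¹ Var g₀ + (N/(N+1)) (E[g₀g₁] − E g₀ · E g₁)` for all `N`
  (`pcg_variance_avg_evolved_eq`, `variance_blockDensity_eq_diag_add_cov`; Mathlib's `variance_fun_sum` = double sum of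
  covariances, and the self/distinct decomposition `pcg_sum_sum_eq`) (§2).
* THE REGISTERED STUB (§3): diagonal `Var g₀ ≤ E g₀² ≤ C(N+1)^{3γ} E g₀ = C(N+1)^{3γ} E ρ̄ ≤ C·B·(N+1)^{3γ}` under the mean
  ceiling `E ρ̄ ≤ B`; off-diagonal `(N/(N+1)) Cov ≤ max A′ 0 · (N+1)^{3γ−1}` under the pair-correlation bound; so
  `Var ρ̄ ≤ (C·B + max A′ 0)(N+1)^{3γ−1}` for `N ≥ max N_B N_{A′}`; `ρ̄ ∈ L²(P_N)` (measurable, bounded, probability law).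
* THE CONVERSE (§4, `pairCorrelation_of_mesoVariance`): `Cov ≤ ((N+1)/N) Var ρ̄ ≤ 2 Var ρ̄` (`N ≥ 1`), so a Poisson-order
  variance gives the pair-correlation bound with constant `2·max A 0` — given the mean ceiling, r2-stub 3 (variance) and
  r3-stub 3 (pair correlation) are EQUIVALENT; whence the RUNGS of r3-stub 3 (§5) from the landed variance anchors:
  equilibrium, every flow, all times (`pairCorrelation_homogeneous` ← `mesoVariance_homogeneous`) and `s = 0` for every nice
  profile (`pairCorrelation_timeZero` ← `mesoVariance_timeZero`).

No definitions, no named facts; axioms `propext`, `Classical.choice`, `Quot.sound`.  References: H. Spohn, *Large Scale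
Dynamics of Interacting Particles* (1991), Part I §2.3 (symmetry of the `N`-particle law, preserved by the dynamics);
A. De Masi, E. Presutti, *Mathematical Methods for Hydrodynamic Limits* (1991), Ch. IX (variance of empirical averages
through the truncated two-point function).
-/

noncomputable section

open MeasureTheory ProbabilityTheory Filter Set Topology
open scoped ENNReal

namespace Summit.AtomisticToContinuum.HydrodynamicLimit.Theorems.MesoChebyshevWindow

open Literature.MathematicalPhysics.KineticTheory Literature.Analysis.FluidPDE
open Summit.AtomisticToContinuum.HydrodynamicLimit.Theorems.VisitLedgerUpscattering (Cfg Flow Flows NiceProfiles)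
open Summit.AtomisticToContinuum.HydrodynamicLimit.Theorems.FibreDeficitTransfer

/-! ## Exchangeability of evolved one- and two-particle observables under the local Gibbs law -/

section Exchangeable

variable (σ : ℝ) (a₀ θ₀ : T3 → ℝ) (u₀ : T3 → V3) (N : ℕ)
  (Φ : HardSphereFlow (Torus.geometry (Fin 3)) (hsDiameter σ N) (N + 1)) (t : ℝ)

/-- **All labels are equivalent** for evolved one-particle observables: `∫ f((Φ_t z)ᵢ) dG_N = ∫ f((Φ_t z)_k) dG_N`
for all labels `i, k`, all profiles, every flow and every time (two-time exchangeability along the transposition of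
`i` and `k`, with a functional ignoring the initial configuration). [folklore] -/
theorem pcg_integral_evolved_eq (f : T3 × V3 → ℝ) (i k : Fin (N + 1)) :
    ∫ z, f (Φ.flow t z i) ∂(localGibbsLaw σ a₀ u₀ θ₀ N Φ) =
      ∫ z, f (Φ.flow t z k) ∂(localGibbsLaw σ a₀ u₀ θ₀ N Φ) :=
  ShearStressHalfDrudeRelabel.integral_self_twoTime_eq σ a₀ θ₀ u₀ N Φ t (fun _ w => f w) i k

/-- **All ordered pairs of distinct labels are equivalent** for evolved two-particle observables: for `i ≠ j` and
`k ≠ l`, `∫ G((Φ_t z)ᵢ, (Φ_t z)ⱼ) dG_N = ∫ G((Φ_t z)_k, (Φ_t z)_l) dG_N` (two-time exchangeability along a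
permutation `π` with `π k = i`, `π l = j`). [folklore] -/
theorem pcg_integral_evolved_pair_eq (G : T3 × V3 → T3 × V3 → ℝ) {i j k l : Fin (N + 1)} (hij : i ≠ j) (hkl : k ≠ l) :
    ∫ z, G (Φ.flow t z i) (Φ.flow t z j) ∂(localGibbsLaw σ a₀ u₀ θ₀ N Φ) =
      ∫ z, G (Φ.flow t z k) (Φ.flow t z l) ∂(localGibbsLaw σ a₀ u₀ θ₀ N Φ) := by
  -- adapted from `ShearStressHalfDrudeRelabel.integral_pair_twoTime_eq`
  obtain ⟨π, hπk, hπl⟩ : ∃ π : Equiv.Perm (Fin (N + 1)), π k = i ∧ π l = j := by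
    have hjk : Equiv.swap k i j ≠ k := fun h => hij (by
      have h' := congrArg (Equiv.swap k i) h
      rwa [Equiv.swap_apply_self, Equiv.swap_apply_left, eq_comm] at h')
    refine ⟨(Equiv.swap l (Equiv.swap k i j)).trans (Equiv.swap k i), ?_, ?_⟩
    · rw [Equiv.trans_apply, Equiv.swap_apply_of_ne_of_ne hkl hjk.symm, Equiv.swap_apply_left]
    · rw [Equiv.trans_apply, Equiv.swap_apply_left, Equiv.swap_apply_self]
  have h := ShearStressHalfDrudeRelabel.integral_twoTime_comp_perm_localGibbsLaw σ a₀ θ₀ u₀ N Φ π t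
    fun _ w => G (w k) (w l)
  simpa only [Function.comp_apply, hπk, hπl] using h

/-- **The mean of the average is the mean of one label**: `∫ (N+1)⁻¹ ∑ᵢ f((Φ_t z)ᵢ) dG_N = ∫ f((Φ_t z)₀) dG_N` for
integrable evolved one-particle observables. [folklore] -/
theorem pcg_integral_avg_evolved_eq (f : T3 × V3 → ℝ)
    (hf : ∀ i, Integrable (fun z => f (Φ.flow t z i)) (localGibbsLaw σ a₀ u₀ θ₀ N Φ)) :
    ∫ z, ((N + 1 : ℕ) : ℝ)⁻¹ * ∑ i, f (Φ.flow t z i) ∂(localGibbsLaw σ a₀ u₀ θ₀ N Φ) =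
      ∫ z, f (Φ.flow t z 0) ∂(localGibbsLaw σ a₀ u₀ θ₀ N Φ) := by
  rw [integral_const_mul, integral_finsetSum _ fun i _ => hf i,
    Finset.sum_congr rfl fun i _ => pcg_integral_evolved_eq σ a₀ θ₀ u₀ N Φ t f i 0, Finset.sum_const,
    Finset.card_univ, Fintype.card_fin, nsmul_eq_mul, ← mul_assoc, inv_mul_cancel₀ (by positivity), one_mul]

/-- **Covariances of evolved one-particle observables at distinct labels are all equal**:
`Cov(f((Φ_t z)ᵢ), f((Φ_t z)ⱼ)) = Cov(f((Φ_t z)₀), f((Φ_t z)₁))` for `i ≠ j` (all means equal the label-`0` mean,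
then pair exchangeability of `(f(a) − m)(f(b) − m)`). [folklore] -/
theorem pcg_covariance_evolved_pair_eq (f : T3 × V3 → ℝ) {i j : Fin (N + 1)} (hij : i ≠ j) :
    cov[fun z => f (Φ.flow t z i), fun z => f (Φ.flow t z j); localGibbsLaw σ a₀ u₀ θ₀ N Φ] =
      cov[fun z => f (Φ.flow t z 0), fun z => f (Φ.flow t z 1); localGibbsLaw σ a₀ u₀ θ₀ N Φ] := by
  -- there is a label `j ≠ i`, so `N ≠ 0` and `0 ≠ 1` in `Fin (N + 1)`
  have hN : NeZero N := ⟨by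
    rintro rfl
    exact hij (Fin.ext (by have := j.isLt; have := i.isLt; omega))⟩
  simp only [covariance]
  rw [pcg_integral_evolved_eq σ a₀ θ₀ u₀ N Φ t f i 0, pcg_integral_evolved_eq σ a₀ θ₀ u₀ N Φ t f j 0,
    pcg_integral_evolved_eq σ a₀ θ₀ u₀ N Φ t f 1 0]
  exact pcg_integral_evolved_pair_eq σ a₀ θ₀ u₀ N Φ t
    (fun a b => (f a - ∫ z, f (Φ.flow t z 0) ∂(localGibbsLaw σ a₀ u₀ θ₀ N Φ)) *
      (f b - ∫ z, f (Φ.flow t z 0) ∂(localGibbsLaw σ a₀ u₀ θ₀ N Φ))) hij Fin.zero_ne_one'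

/-- **Variances of evolved one-particle observables are all equal**: `Cov(gᵢ, gᵢ) = Var g₀`, `gᵢ = f((Φ_t z)ᵢ)`. [folklore] -/
theorem pcg_covariance_evolved_self_eq (f : T3 × V3 → ℝ)
    (hf : ∀ i, AEMeasurable (fun z => f (Φ.flow t z i)) (localGibbsLaw σ a₀ u₀ θ₀ N Φ)) (i : Fin (N + 1)) :
    cov[fun z => f (Φ.flow t z i), fun z => f (Φ.flow t z i); localGibbsLaw σ a₀ u₀ θ₀ N Φ] =
      variance (fun z => f (Φ.flow t z 0)) (localGibbsLaw σ a₀ u₀ θ₀ N Φ) := by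
  rw [← covariance_self (hf 0)]
  simp only [covariance]
  rw [pcg_integral_evolved_eq σ a₀ θ₀ u₀ N Φ t f i 0]
  exact pcg_integral_evolved_eq σ a₀ θ₀ u₀ N Φ t
    (fun a => (f a - ∫ z, f (Φ.flow t z 0) ∂(localGibbsLaw σ a₀ u₀ θ₀ N Φ)) *
      (f a - ∫ z, f (Φ.flow t z 0) ∂(localGibbsLaw σ a₀ u₀ θ₀ N Φ))) i 0

end Exchangeable

/-! ## The exact variance identity -/

/-- **Self/distinct decomposition of a double sum over labels** whose terms only depend on whether the labels
coincide: `∑ᵢ ∑ⱼ cᵢⱼ = (N+1)(d + N e)` if `cᵢᵢ = d` and `cᵢⱼ = e` for `i ≠ j`. [folklore] -/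
theorem pcg_sum_sum_eq {N : ℕ} (c : Fin (N + 1) → Fin (N + 1) → ℝ) {d e : ℝ} (hd : ∀ i, c i i = d)
    (he : ∀ i j, i ≠ j → c i j = e) :
    ∑ i, ∑ j, c i j = ((N : ℝ) + 1) * (d + (N : ℝ) * e) := by
  have hinner : ∀ i : Fin (N + 1), ∑ j, c i j = d + (N : ℝ) * e := by
    intro i
    rw [← Finset.add_sum_erase _ _ (Finset.mem_univ i), hd i]
    congr 1
    rw [Finset.sum_congr rfl fun j hj => he i j (Finset.ne_of_mem_erase hj).symm, Finset.sum_const,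
      nsmul_eq_mul, Finset.card_erase_of_mem (Finset.mem_univ i), Finset.card_univ, Fintype.card_fin,
      Nat.add_sub_cancel]
  simp only [hinner, Finset.sum_const, Finset.card_univ, Fintype.card_fin, nsmul_eq_mul, Nat.cast_add, Nat.cast_one]

/-- **Exact variance identity for the average of an evolved one-particle observable under the (exchangeable) local
Gibbs law.**  For square-integrable `gᵢ(z) = f((Φ_t z)ᵢ)` and a finite law,
`Var((N+1)⁻¹ ∑ᵢ gᵢ) = (N+1)⁻¹ Var g₀ + (N/(N+1)) (E[g₀g₁] − E g₀ · E g₁)`: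
`Var(∑ᵢ gᵢ) = ∑ᵢ∑ⱼ Cov(gᵢ, gⱼ)` (Mathlib), every diagonal covariance is `Var g₀` and every off-diagonal one is
`Cov(g₀, g₁)` (exchangeability), and there are `N+1` diagonal and `(N+1)N` off-diagonal terms. [folklore] -/
theorem pcg_variance_avg_evolved_eq {σ : ℝ} {a₀ θ₀ : T3 → ℝ} {u₀ : T3 → V3} {N : ℕ}
    {Φ : HardSphereFlow (Torus.geometry (Fin 3)) (hsDiameter σ N) (N + 1)} {t : ℝ}
    [IsProbabilityMeasure (localGibbsLaw σ a₀ u₀ θ₀ N Φ)] {f : T3 × V3 → ℝ}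
    (hf : ∀ i, MemLp (fun z => f (Φ.flow t z i)) 2 (localGibbsLaw σ a₀ u₀ θ₀ N Φ)) :
    variance (fun z => ((N + 1 : ℕ) : ℝ)⁻¹ * ∑ i, f (Φ.flow t z i)) (localGibbsLaw σ a₀ u₀ θ₀ N Φ) =
      ((N : ℝ) + 1)⁻¹ * variance (fun z => f (Φ.flow t z 0)) (localGibbsLaw σ a₀ u₀ θ₀ N Φ) +
        (N : ℝ) / ((N : ℝ) + 1) *
          ((∫ z, f (Φ.flow t z 0) * f (Φ.flow t z 1) ∂(localGibbsLaw σ a₀ u₀ θ₀ N Φ)) -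
            (∫ z, f (Φ.flow t z 0) ∂(localGibbsLaw σ a₀ u₀ θ₀ N Φ)) *
              (∫ z, f (Φ.flow t z 1) ∂(localGibbsLaw σ a₀ u₀ θ₀ N Φ))) := by
  have hsum : variance (fun z => ∑ i, f (Φ.flow t z i)) (localGibbsLaw σ a₀ u₀ θ₀ N Φ) =
      ∑ i, ∑ j, cov[fun z => f (Φ.flow t z i), fun z => f (Φ.flow t z j); localGibbsLaw σ a₀ u₀ θ₀ N Φ] :=
    variance_fun_sum (X := fun i z => f (Φ.flow t z i)) hf
  have hcov : cov[fun z => f (Φ.flow t z 0), fun z => f (Φ.flow t z 1); localGibbsLaw σ a₀ u₀ θ₀ N Φ] =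
      (∫ z, f (Φ.flow t z 0) * f (Φ.flow t z 1) ∂(localGibbsLaw σ a₀ u₀ θ₀ N Φ)) -
        (∫ z, f (Φ.flow t z 0) ∂(localGibbsLaw σ a₀ u₀ θ₀ N Φ)) *
          (∫ z, f (Φ.flow t z 1) ∂(localGibbsLaw σ a₀ u₀ θ₀ N Φ)) := by
    rw [covariance_eq_sub (hf 0) (hf 1)]
    rfl
  rw [variance_const_mul, hsum, pcg_sum_sum_eq _ (pcg_covariance_evolved_self_eq σ a₀ θ₀ u₀ N Φ t f
      fun i => (hf i).aestronglyMeasurable.aemeasurable)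
    (fun i j hij => pcg_covariance_evolved_pair_eq σ a₀ θ₀ u₀ N Φ t f hij), hcov]
  have hn : ((N : ℝ) + 1) ≠ 0 := by positivity
  push_cast
  field_simp

/-- **(x1) Exact variance identity for the kernel block density** `ρ̄(z) = empiricalDensityField (Φ_t z) (φ(· − x)) =
(N+1)⁻¹ ∑ᵢ φ(qᵢ(t) − x)` under a probability local Gibbs law, for a continuous kernel `φ` with `|φ| ≤ K`:
`Var ρ̄ = (N+1)⁻¹ Var g₀ + (N/(N+1)) (E[g₀g₁] − E g₀ · E g₁)`, `gᵢ(z) = φ((Φ_t z)ᵢ.1 − x)`. [folklore] -/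
theorem variance_blockDensity_eq_diag_add_cov {σ : ℝ} {a₀ θ₀ : T3 → ℝ} {u₀ : T3 → V3} {N : ℕ}
    (Φ : HardSphereFlow (Torus.geometry (Fin 3)) (hsDiameter σ N) (N + 1)) (t : ℝ)
    [IsProbabilityMeasure (localGibbsLaw σ a₀ u₀ θ₀ N Φ)] {φ : T3 → ℝ} (hφ : Continuous φ) {K : ℝ}
    (hK : ∀ y, |φ y| ≤ K) (x : T3) :
    variance (fun z => empiricalDensityField (Φ.flow t z) (fun y => φ (y - x))) (localGibbsLaw σ a₀ u₀ θ₀ N Φ) =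
      ((N : ℝ) + 1)⁻¹ * variance (fun z => φ ((Φ.flow t z 0).1 - x)) (localGibbsLaw σ a₀ u₀ θ₀ N Φ) +
        (N : ℝ) / ((N : ℝ) + 1) *
          ((∫ z, φ ((Φ.flow t z 0).1 - x) * φ ((Φ.flow t z 1).1 - x) ∂(localGibbsLaw σ a₀ u₀ θ₀ N Φ)) -
            (∫ z, φ ((Φ.flow t z 0).1 - x) ∂(localGibbsLaw σ a₀ u₀ θ₀ N Φ)) *
              (∫ z, φ ((Φ.flow t z 1).1 - x) ∂(localGibbsLaw σ a₀ u₀ θ₀ N Φ))) := by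
  have hρ : (fun z => empiricalDensityField (Φ.flow t z) (fun y => φ (y - x))) =
      fun z => ((N + 1 : ℕ) : ℝ)⁻¹ * ∑ i, φ ((Φ.flow t z i).1 - x) :=
    funext fun z => AprioriBoundsNegative.blockDensity_eq _ _ _
  have hg2 : ∀ i, MemLp (fun z => φ ((Φ.flow t z i).1 - x)) 2 (localGibbsLaw σ a₀ u₀ θ₀ N Φ) := fun i =>
    memLp_of_bounded (a := -K) (b := K) (ae_of_all _ fun z => abs_le.1 (hK _))
      ((hφ.comp (continuous_fst.sub continuous_const)).measurable.comp
        ((measurable_pi_apply i).comp (Φ.measurable_flow t))).aestronglyMeasurable 2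
  rw [hρ]
  exact pcg_variance_avg_evolved_eq (f := fun a => φ (a.1 - x)) hg2

/-! ## The registered stub -/

/-- Arithmetic: `q c ≤ max a 0 · p` for `0 ≤ q ≤ 1`, `0 ≤ p` and `c ≤ a p` (both signs of `c`). -/
theorem pcg_mul_le_max_mul {q c a p : ℝ} (hq0 : 0 ≤ q) (hq1 : q ≤ 1) (hp : 0 ≤ p) (hc : c ≤ a * p) :
    q * c ≤ max a 0 * p := by
  rcases le_or_gt 0 c with h | h
  · exact (mul_le_of_le_one_left h hq1).trans (hc.trans (mul_le_mul_of_nonneg_right (le_max_left _ _) hp))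
  · exact (mul_nonpos_of_nonneg_of_nonpos hq0 h.le).trans (mul_nonneg (le_max_right _ _) hp)

/-- **W2 · `stub_mesoVariance_of_pairCorrelation`** (registered stub 4 of the r3 skeleton of the line
`meso-chebyshev-window`, the exchangeability glue of the (ii)-half): for `0 < σ ≤ 1/2`, nice profiles, every flow
family, horizon, `γ > 0` and admissible kernel family, a MEAN CEILING `E_{P_N} ρ̄_φ(s,x) ≤ B` and a PAIR-CORRELATION
BOUND `E[g₀g₁] − E g₀ E g₁ ≤ A′(N+1)^{3γ−1}` (eventually in `N`, uniformly on `[0,t] × 𝕋³`) give `ρ̄_φ(s,x) ∈ L²(P_N)`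
and `Var_{P_N} ρ̄_φ(s,x) ≤ A(N+1)^{3γ−1}` with `A := C·B + max A′ 0` for `N ≥ max N_B N_{A′}`: the exact identity
(`pcg_variance_avg_evolved_eq`), the diagonal `Var g₀ ≤ E g₀² ≤ C(N+1)^{3γ} E g₀ = C(N+1)^{3γ} E ρ̄ ≤ C B (N+1)^{3γ}`
(`0 ≤ g₀ ≤ C(N+1)^{3γ}`, `E ρ̄ = E g₀` by exchangeability) and `(N/(N+1)) Cov ≤ max A′ 0 · (N+1)^{3γ−1}`. -/
theorem stub_mesoVariance_of_pairCorrelation :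
    ∀ (σ : ℝ) (a₀ θ₀ : T3 → ℝ) (u₀ : T3 → V3)
      (Φ : (N : ℕ) → HardSphereFlow (Torus.geometry (Fin 3)) (hsDiameter σ N) (N + 1)) (t : ℝ),
      0 < σ → σ ≤ 1 / 2 → NiceProfiles a₀ θ₀ u₀ →
      ∀ (γ C : ℝ) (φ : ℕ → T3 → ℝ), 0 < γ →
        ((∀ N, Literature.Analysis.FunctionSpaces.Torus.IsSmooth (φ N)) ∧ (∀ N y, 0 ≤ φ N y) ∧
          (∀ N, ∫ y, φ N y = 1) ∧
          (∀ (N : ℕ) y, ((N : ℝ) + 1) ^ (-γ) ≤ Torus.euclidDist y 0 → φ N y = 0) ∧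
          (∀ (N : ℕ) y, φ N y ≤ C * ((N : ℝ) + 1) ^ (3 * γ)) ∧
          (∀ (N : ℕ) y, ‖Literature.Analysis.FunctionSpaces.Torus.gradient (φ N) y‖ ≤
            C * ((N : ℝ) + 1) ^ (4 * γ))) →
        (∃ B : ℝ, ∃ N₀ : ℕ, ∀ N : ℕ, N₀ ≤ N → ∀ s ∈ Icc 0 t, ∀ x : T3,
          ∫ z, empiricalDensityField ((Φ N).flow s z) (fun y => φ N (y - x))
            ∂(localGibbsLaw σ a₀ u₀ θ₀ N (Φ N)) ≤ B) →
        (∃ A : ℝ, ∃ N₀ : ℕ, ∀ N : ℕ, N₀ ≤ N → ∀ s ∈ Icc 0 t, ∀ x : T3,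
          (∫ z, φ N (((Φ N).flow s z 0).1 - x) * φ N (((Φ N).flow s z 1).1 - x)
              ∂(localGibbsLaw σ a₀ u₀ θ₀ N (Φ N))) -
            (∫ z, φ N (((Φ N).flow s z 0).1 - x) ∂(localGibbsLaw σ a₀ u₀ θ₀ N (Φ N))) *
              (∫ z, φ N (((Φ N).flow s z 1).1 - x) ∂(localGibbsLaw σ a₀ u₀ θ₀ N (Φ N))) ≤
          A * ((N : ℝ) + 1) ^ (3 * γ - 1)) →
        ∃ A : ℝ, ∃ N₀ : ℕ, ∀ N : ℕ, N₀ ≤ N → ∀ s ∈ Icc 0 t, ∀ x : T3,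
          MemLp (fun z => empiricalDensityField ((Φ N).flow s z) (fun y => φ N (y - x))) 2
              (localGibbsLaw σ a₀ u₀ θ₀ N (Φ N)) ∧
            variance (fun z => empiricalDensityField ((Φ N).flow s z) (fun y => φ N (y - x)))
              (localGibbsLaw σ a₀ u₀ θ₀ N (Φ N)) ≤ A * ((N : ℝ) + 1) ^ (3 * γ - 1) := by
  intro σ a₀ θ₀ u₀ Φ t _hσ hσ2 hprof γ C φ _hγ hadm hB hA
  obtain ⟨ha, hθ, hu, ha0, hθ0⟩ := hprof
  obtain ⟨hsm, hpos, -, -, hle, -⟩ := hadm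
  obtain ⟨B, NB, hNB⟩ := hB
  obtain ⟨A', NA, hNA⟩ := hA
  -- `C ≥ 0`, from `0 ≤ φ₀ 0 ≤ C · 1^{3γ}`
  have hC0 : 0 ≤ C := by
    have h := (hpos 0 0).trans (hle 0 0)
    rwa [Nat.cast_zero, zero_add, Real.one_rpow, mul_one] at h
  refine ⟨C * B + max A' 0, max NB NA, fun N hN s hs x => ?_⟩
  have hNB' : NB ≤ N := le_of_max_le_left hN
  have hNA' : NA ≤ N := le_of_max_le_right hN
  haveI : IsProbabilityMeasure (localGibbsLaw σ a₀ u₀ θ₀ N (Φ N)) :=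
    isProbabilityMeasure_localGibbsLaw ha hθ hu ha0 hθ0 hσ2 N (Φ N)
  have hn0 : (0 : ℝ) < (N : ℝ) + 1 := by positivity
  have hK0 : 0 ≤ C * ((N : ℝ) + 1) ^ (3 * γ) := mul_nonneg hC0 (Real.rpow_nonneg hn0.le _)
  -- the evolved observables `gᵢ(z) = φ_N((Φ_s z)ᵢ.1 - x)`: measurable, `0 ≤ gᵢ ≤ C(N+1)^{3γ}`, in `L²`
  have hgm : ∀ i, Measurable fun z : Cfg N => φ N (((Φ N).flow s z i).1 - x) := fun i =>
    ((hsm N).continuous.comp (continuous_fst.sub continuous_const)).measurable.comp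
      ((measurable_pi_apply i).comp ((Φ N).measurable_flow s))
  have hg2 : ∀ i, MemLp (fun z : Cfg N => φ N (((Φ N).flow s z i).1 - x)) 2 (localGibbsLaw σ a₀ u₀ θ₀ N (Φ N)) :=
    fun i => memLp_of_bounded (a := 0) (b := C * ((N : ℝ) + 1) ^ (3 * γ))
      (ae_of_all _ fun z => ⟨hpos N _, hle N _⟩) (hgm i).aestronglyMeasurable 2
  have hg1 : ∀ i, Integrable (fun z : Cfg N => φ N (((Φ N).flow s z i).1 - x)) (localGibbsLaw σ a₀ u₀ θ₀ N (Φ N)) :=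
    fun i => (hg2 i).integrable one_le_two
  -- the block density is the average of the `gᵢ`
  have hρ : (fun z => empiricalDensityField ((Φ N).flow s z) (fun y => φ N (y - x))) =
      fun z => ((N + 1 : ℕ) : ℝ)⁻¹ * ∑ i, φ N (((Φ N).flow s z i).1 - x) :=
    funext fun z => AprioriBoundsNegative.blockDensity_eq _ _ _
  refine ⟨?_, ?_⟩
  · rw [hρ]
    exact (memLp_finsetSum _ fun i _ => hg2 i).const_mul _
  · -- mean: `E g₀ = E ρ̄ ≤ B`
    have hmean : ∫ z, φ N (((Φ N).flow s z 0).1 - x) ∂(localGibbsLaw σ a₀ u₀ θ₀ N (Φ N)) ≤ B := by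
      have h := hNB N hNB' s hs x
      rwa [hρ, pcg_integral_avg_evolved_eq σ a₀ θ₀ u₀ N (Φ N) s (fun a => φ N (a.1 - x)) hg1] at h
    -- diagonal: `Var g₀ ≤ E g₀² ≤ C(N+1)^{3γ} E g₀ ≤ C(N+1)^{3γ} B`
    have hdiag : variance (fun z => φ N (((Φ N).flow s z 0).1 - x)) (localGibbsLaw σ a₀ u₀ θ₀ N (Φ N)) ≤
        C * ((N : ℝ) + 1) ^ (3 * γ) * B := by
      refine (variance_le_expectation_sq (hgm 0).aestronglyMeasurable).trans ?_
      calc ∫ z, ((fun z : Cfg N => φ N (((Φ N).flow s z 0).1 - x)) ^ 2) z ∂(localGibbsLaw σ a₀ u₀ θ₀ N (Φ N))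
          ≤ ∫ z, C * ((N : ℝ) + 1) ^ (3 * γ) * φ N (((Φ N).flow s z 0).1 - x)
              ∂(localGibbsLaw σ a₀ u₀ θ₀ N (Φ N)) := by
            refine integral_mono ?_ ((hg1 0).const_mul _) fun z => ?_
            · exact (hg2 0).integrable_sq
            · simp only [Pi.pow_apply]
              rw [sq]
              exact mul_le_mul_of_nonneg_right (hle N _) (hpos N _)
        _ = C * ((N : ℝ) + 1) ^ (3 * γ) * ∫ z, φ N (((Φ N).flow s z 0).1 - x)
              ∂(localGibbsLaw σ a₀ u₀ θ₀ N (Φ N)) := integral_const_mul _ _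
        _ ≤ C * ((N : ℝ) + 1) ^ (3 * γ) * B := mul_le_mul_of_nonneg_left hmean hK0
    -- regroup: `(N+1)⁻¹ · C(N+1)^{3γ} B = C B (N+1)^{3γ-1}` and `(N/(N+1)) Cov ≤ max A' 0 · (N+1)^{3γ-1}`
    have hpow : ((N : ℝ) + 1) ^ (3 * γ) = ((N : ℝ) + 1) * ((N : ℝ) + 1) ^ (3 * γ - 1) := by
      rw [Real.rpow_sub hn0, Real.rpow_one, mul_div_cancel₀ _ hn0.ne']
    have hdiag' : ((N : ℝ) + 1)⁻¹ * variance (fun z => φ N (((Φ N).flow s z 0).1 - x))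
        (localGibbsLaw σ a₀ u₀ θ₀ N (Φ N)) ≤ C * B * ((N : ℝ) + 1) ^ (3 * γ - 1) := by
      refine (mul_le_mul_of_nonneg_left hdiag (inv_nonneg.2 hn0.le)).trans (le_of_eq ?_)
      rw [hpow]
      field_simp
    rw [hρ, pcg_variance_avg_evolved_eq (f := fun a => φ N (a.1 - x)) hg2]
    calc _ ≤ C * B * ((N : ℝ) + 1) ^ (3 * γ - 1) + max A' 0 * ((N : ℝ) + 1) ^ (3 * γ - 1) :=
          add_le_add hdiag' (pcg_mul_le_max_mul (by positivity) ((div_le_one hn0).2 (by linarith))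
            (Real.rpow_nonneg hn0.le _) (hNA N hNA' s hs x))
      _ = (C * B + max A' 0) * ((N : ℝ) + 1) ^ (3 * γ - 1) := by ring

/-! ## The converse: a Poisson-order variance gives the pair-correlation bound -/

/-- **The truncated pair correlation is at most twice the variance of the block density** (`N ≥ 1`, probability law,
continuous `|φ| ≤ K`): `E[g₀g₁] − E g₀ E g₁ ≤ 2 Var ρ̄` (`(N/(N+1)) Cov = Var ρ̄ − (N+1)⁻¹ Var g₀ ≤ Var ρ̄`). [folklore] -/
theorem pcg_cov_le_two_mul_variance_blockDensity {σ : ℝ} {a₀ θ₀ : T3 → ℝ} {u₀ : T3 → V3} {N : ℕ} (hN : 1 ≤ N)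
    (Φ : HardSphereFlow (Torus.geometry (Fin 3)) (hsDiameter σ N) (N + 1)) (t : ℝ)
    [IsProbabilityMeasure (localGibbsLaw σ a₀ u₀ θ₀ N Φ)] {φ : T3 → ℝ} (hφ : Continuous φ) {K : ℝ}
    (hK : ∀ y, |φ y| ≤ K) (x : T3) :
    (∫ z, φ ((Φ.flow t z 0).1 - x) * φ ((Φ.flow t z 1).1 - x) ∂(localGibbsLaw σ a₀ u₀ θ₀ N Φ)) -
        (∫ z, φ ((Φ.flow t z 0).1 - x) ∂(localGibbsLaw σ a₀ u₀ θ₀ N Φ)) *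
          (∫ z, φ ((Φ.flow t z 1).1 - x) ∂(localGibbsLaw σ a₀ u₀ θ₀ N Φ)) ≤
      2 * variance (fun z => empiricalDensityField (Φ.flow t z) (fun y => φ (y - x))) (localGibbsLaw σ a₀ u₀ θ₀ N Φ) := by
  have hid := variance_blockDensity_eq_diag_add_cov Φ t (a₀ := a₀) (θ₀ := θ₀) (u₀ := u₀) hφ hK x
  set V := variance (fun z => empiricalDensityField (Φ.flow t z) (fun y => φ (y - x))) (localGibbsLaw σ a₀ u₀ θ₀ N Φ)
  set V0 := variance (fun z => φ ((Φ.flow t z 0).1 - x)) (localGibbsLaw σ a₀ u₀ θ₀ N Φ)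
  set Cv := (∫ z, φ ((Φ.flow t z 0).1 - x) * φ ((Φ.flow t z 1).1 - x) ∂(localGibbsLaw σ a₀ u₀ θ₀ N Φ)) -
    (∫ z, φ ((Φ.flow t z 0).1 - x) ∂(localGibbsLaw σ a₀ u₀ θ₀ N Φ)) *
      (∫ z, φ ((Φ.flow t z 1).1 - x) ∂(localGibbsLaw σ a₀ u₀ θ₀ N Φ))
  have hVn : 0 ≤ V := variance_nonneg _ _
  have hV0n : 0 ≤ V0 := variance_nonneg _ _
  have hn : ((N : ℝ) + 1) ≠ 0 := by positivity
  have hN1 : (1 : ℝ) ≤ N := by exact_mod_cast hN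
  have hNpos : (0 : ℝ) < N := by linarith
  have h1 : ((N : ℝ) + 1) * V = V0 + (N : ℝ) * Cv := by
    rw [hid]
    field_simp
  have h2 : (N : ℝ) * Cv ≤ (N : ℝ) * (2 * V) := by
    nlinarith [h1, hV0n, mul_nonneg (sub_nonneg.2 hN1) hVn]
  exact le_of_mul_le_mul_left h2 hNpos

/-- **(x2) The CONVERSE of the glue: a Poisson-order variance of the block density gives the pair-correlation bound.**
For `0 < σ ≤ 1/2`, nice profiles, every flow family, horizon, `γ > 0` and admissible kernel family: if `ρ̄_φ(s,x) ∈ L²(P_N)`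
and `Var_{P_N} ρ̄_φ(s,x) ≤ A(N+1)^{3γ−1}` eventually, uniformly on `[0,t] × 𝕋³` (the conclusion block of r2-stub
`stub_mesoVariance` verbatim), then `E[g₀g₁] − E g₀ E g₁ ≤ 2·max A 0·(N+1)^{3γ−1}` for `N ≥ max N₀ 1`.  With
`stub_mesoVariance_of_pairCorrelation`: given the mean ceiling, r2-stub 3 (variance) and r3-stub 3 (pairs) are EQUIVALENT. -/
theorem pairCorrelation_of_mesoVariance : ∀ (σ : ℝ) (a₀ θ₀ : T3 → ℝ) (u₀ : T3 → V3) (Φ : (N : ℕ) → HardSphereFlow (Torus.geometry (Fin 3)) (hsDiameter σ N) (N + 1)) (t : ℝ), 0 < σ → σ ≤ 1 / 2 → NiceProfiles a₀ θ₀ u₀ → ∀ (γ C : ℝ) (φ : ℕ → T3 → ℝ), 0 < γ → ((∀ N, Literature.Analysis.FunctionSpaces.Torus.IsSmooth (φ N)) ∧ (∀ N y, 0 ≤ φ N y) ∧ (∀ N, ∫ y, φ N y = 1) ∧ (∀ (N : ℕ) y, ((N : ℝ) + 1) ^ (-γ) ≤ Torus.euclidDist y 0 → φ N y = 0) ∧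 (∀ (N : ℕ) y, φ N y ≤ C * ((N : ℝ) + 1) ^ (3 * γ)) ∧ (∀ (N : ℕ) y, ‖Literature.Analysis.FunctionSpaces.Torus.gradient (φ N) y‖ ≤ C * ((N : ℝ) + 1) ^ (4 * γ))) → (∃ A : ℝ, ∃ N₀ : ℕ, ∀ N : ℕ, N₀ ≤ N → ∀ s ∈ Icc 0 t, ∀ x : T3, MemLp (fun z => empiricalDensityField ((Φ N).flow s z) (fun y => φ N (y - x))) 2 (localGibbsLaw σ a₀ u₀ θ₀ N (Φ N)) ∧ variance (fun z => empiricalDensityField ((Φ N).flow s z) (fun y => φ N (y - x))) (localGibbsLaw σ a₀ u₀ θ₀ N (Φ N)) ≤ A * ((N : ℝ) + 1) ^ (3 * γ - 1)) → ∃ A : ℝ, ∃ N₀ : ℕ, ∀ N : ℕ, N₀ ≤ N → ∀ s ∈ Icc 0 t, ∀ x : T3, (∫ z, φ N (((Φ N).flow s z 0).1 - x) * φ N (((Φ N).flow s z 1).1 - x) ∂(localGibbsLaw σ a₀ u₀ θ₀ N (Φ N))) - (∫ z, φ N (((Φ N).flow s z 0).1 - x) ∂(localGibbsLaw σ a₀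 u₀ θ₀ N (Φ N))) * (∫ z, φ N (((Φ N).flow s z 1).1 - x) ∂(localGibbsLaw σ a₀ u₀ θ₀ N (Φ N))) ≤ A * ((N : ℝ) + 1) ^ (3 * γ - 1) := by
  intro σ a₀ θ₀ u₀ Φ t _hσ hσ2 hprof γ C φ _hγ hadm hV
  obtain ⟨ha, hθ, hu, ha0, hθ0⟩ := hprof
  obtain ⟨hsm, hpos, -, -, hle, -⟩ := hadm
  obtain ⟨A, NA, hNA⟩ := hV
  refine ⟨2 * max A 0, max NA 1, fun N hN s hs x => ?_⟩
  have hNA' : NA ≤ N := le_of_max_le_left hN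
  have hN1 : 1 ≤ N := le_of_max_le_right hN
  haveI : IsProbabilityMeasure (localGibbsLaw σ a₀ u₀ θ₀ N (Φ N)) :=
    isProbabilityMeasure_localGibbsLaw ha hθ hu ha0 hθ0 hσ2 N (Φ N)
  have hn0 : (0 : ℝ) < (N : ℝ) + 1 := by positivity
  have hp0 : 0 ≤ ((N : ℝ) + 1) ^ (3 * γ - 1) := Real.rpow_nonneg hn0.le _
  have hK : ∀ y, |φ N y| ≤ C * ((N : ℝ) + 1) ^ (3 * γ) := fun y => abs_le.2 ⟨by linarith [hpos N y, hle N y], hle N y⟩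
  refine (pcg_cov_le_two_mul_variance_blockDensity (a₀ := a₀) (θ₀ := θ₀) (u₀ := u₀) hN1 (Φ N) s (hsm N).continuous hK
    x).trans ?_
  linarith [(hNA N hNA' s hs x).2, mul_le_mul_of_nonneg_right (le_max_left A 0) hp0]

/-! ## Rungs of the pair-correlation stub (x3): equilibrium, and time zero for every nice profile -/

/-- **(x3a) The pair-correlation bound AT CONSTANT DATA, for every flow family and all times** (equilibrium rung of
r3-stub 3 `stub_pairCorrelation`, its conclusion block verbatim with the profiles specialised to positive constants):
there is `σ₀ > 0` such that for `0 < σ < σ₀`, `a, θ > 0`, every flow family, `t`, `γ ∈ (0, 1/15]` and admissible kernel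
family, `E[g₀g₁] − E g₀ E g₁ ≤ A(N+1)^{3γ−1}` eventually, uniformly on `[0,t] × 𝕋³` (`mesoVariance_homogeneous` — canonical
cluster expansion + flow invariance — through `pairCorrelation_of_mesoVariance`; `σ₀ ∧ 1/2`: probability laws). -/
theorem pairCorrelation_homogeneous : ∃ σ₀ : ℝ, 0 < σ₀ ∧ ∀ (σ a θ : ℝ) (u : V3), 0 < σ → σ < σ₀ → 0 < a → 0 < θ → ∀ (Φ : (N : ℕ) → HardSphereFlow (Torus.geometry (Fin 3)) (hsDiameter σ N) (N + 1)) (t γ C : ℝ) (φ : ℕ → T3 → ℝ), 0 < γ → γ ≤ 1 / 15 → ((∀ N, Literature.Analysis.FunctionSpaces.Torus.IsSmooth (φ N)) ∧ (∀ N y, 0 ≤ φ N y) ∧ (∀ N, ∫ y, φ N y = 1) ∧ (∀ (N : ℕ) y, ((N : ℝ) + 1) ^ (-γ) ≤ Torus.euclidDist y 0 → φ N y = 0) ∧ (∀ (N : ℕ) y, φ N y ≤ C * ((N : ℝ) + 1) ^ (3 * γ)) ∧ (∀ (N : ℕ) y, ‖Literature.Analysis.FunctionSpaces.Torus.gradient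 (φ N) y‖ ≤ C * ((N : ℝ) + 1) ^ (4 * γ))) → ∃ A : ℝ, ∃ N₀ : ℕ, ∀ N : ℕ, N₀ ≤ N → ∀ s ∈ Icc 0 t, ∀ x : T3, (∫ z, φ N (((Φ N).flow s z 0).1 - x) * φ N (((Φ N).flow s z 1).1 - x) ∂(localGibbsLaw σ (fun _ => a) (fun _ => u) (fun _ => θ) N (Φ N))) - (∫ z, φ N (((Φ N).flow s z 0).1 - x) ∂(localGibbsLaw σ (fun _ => a) (fun _ => u) (fun _ => θ) N (Φ N))) * (∫ z, φ N (((Φ N).flow s z 1).1 - x) ∂(localGibbsLaw σ (fun _ => a) (fun _ => u) (fun _ => θ) N (Φ N))) ≤ A * ((N : ℝ) + 1) ^ (3 * γ - 1) := by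
  obtain ⟨σ₀, hσ₀, H⟩ := mesoVariance_homogeneous
  refine ⟨min σ₀ (1 / 2), lt_min hσ₀ one_half_pos, ?_⟩
  intro σ a θ u hσ hσlt ha hθ Φ t γ C φ hγ hγ' hadm
  have hσ1 : σ < σ₀ := hσlt.trans_le (min_le_left _ _)
  have hσ2 : σ ≤ 1 / 2 := (hσlt.trans_le (min_le_right _ _)).le
  have hprof : NiceProfiles (fun _ : T3 => a) (fun _ : T3 => θ) (fun _ : T3 => u) :=
    ⟨continuous_const, continuous_const, continuous_const, fun _ => ha, fun _ => hθ⟩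
  exact pairCorrelation_of_mesoVariance σ (fun _ => a) (fun _ => θ) (fun _ => u) Φ t hσ hσ2 hprof γ C φ hγ hadm
    (H σ a θ u hσ hσ1 ha hθ Φ t γ C φ hγ hγ' hadm)

/-- **(x3b) The pair-correlation bound AT TIME ZERO, for every nice (inhomogeneous) profile and every flow family**
(`s = 0` rung of r3-stub 3 `stub_pairCorrelation`): for continuous positive profiles there is `σ₀ > 0` such that for
`0 < σ < σ₀`, every flow family, `γ ∈ (0, 1/15]` and admissible kernel family, `E[g₀g₁] − E g₀ E g₁ ≤ A(N+1)^{3γ−1}` at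
`s = 0`, eventually in `N`, uniformly in `x` (`mesoVariance_timeZero` — inhomogeneous canonical cluster expansion —
through `pairCorrelation_of_mesoVariance` at horizon `t = 0`). -/
theorem pairCorrelation_timeZero : ∀ (a₀ θ₀ : T3 → ℝ) (u₀ : T3 → V3), Continuous a₀ → Continuous θ₀ → Continuous u₀ → (∀ x, 0 < a₀ x) → (∀ x, 0 < θ₀ x) → ∃ σ₀ : ℝ, 0 < σ₀ ∧ ∀ σ : ℝ, 0 < σ → σ < σ₀ → ∀ (Φ : (N : ℕ) → HardSphereFlow (Torus.geometry (Fin 3)) (hsDiameter σ N) (N + 1)) (γ C : ℝ) (φ : ℕ → T3 → ℝ), 0 < γ → γ ≤ 1 / 15 → ((∀ N, Literature.Analysis.FunctionSpaces.Torus.IsSmooth (φ N)) ∧ (∀ N y, 0 ≤ φ N y) ∧ (∀ N, ∫ y, φ N y = 1) ∧ (∀ (N : ℕ) y, ((N : ℝ) + 1) ^ (-γ) ≤ Torus.euclidDist y 0 → φ N y = 0) ∧ (∀ (N : ℕ) y, φ N y ≤ C * ((N : ℝ) + 1) ^ (3 * γ)) ∧ (∀ (N : ℕ) y, ‖Literature.Analysis.FunctionSpaces.Torus.gradient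 (φ N) y‖ ≤ C * ((N : ℝ) + 1) ^ (4 * γ))) → ∃ A : ℝ, ∃ N₀ : ℕ, ∀ N : ℕ, N₀ ≤ N → ∀ x : T3, (∫ z, φ N (((Φ N).flow 0 z 0).1 - x) * φ N (((Φ N).flow 0 z 1).1 - x) ∂(localGibbsLaw σ a₀ u₀ θ₀ N (Φ N))) - (∫ z, φ N (((Φ N).flow 0 z 0).1 - x) ∂(localGibbsLaw σ a₀ u₀ θ₀ N (Φ N))) * (∫ z, φ N (((Φ N).flow 0 z 1).1 - x) ∂(localGibbsLaw σ a₀ u₀ θ₀ N (Φ N))) ≤ A * ((N : ℝ) + 1) ^ (3 * γ - 1) := by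
  intro a₀ θ₀ u₀ ha hθ hu ha0 hθ0
  obtain ⟨σ₀, hσ₀, H⟩ := mesoVariance_timeZero a₀ θ₀ u₀ ha hθ hu ha0 hθ0
  refine ⟨min σ₀ (1 / 2), lt_min hσ₀ one_half_pos, ?_⟩
  intro σ hσ hσlt Φ γ C φ hγ hγ' hadm
  have hσ1 : σ < σ₀ := hσlt.trans_le (min_le_left _ _)
  have hσ2 : σ ≤ 1 / 2 := (hσlt.trans_le (min_le_right _ _)).le
  have hprof : NiceProfiles a₀ θ₀ u₀ := ⟨ha, hθ, hu, ha0, hθ0⟩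
  obtain ⟨A, N₀, hAN⟩ := H σ hσ hσ1 Φ γ C φ hγ hγ' hadm
  -- the variance block at horizon `t = 0`: `s ∈ [0, 0]` forces `s = 0`
  have hV : ∃ A : ℝ, ∃ N₀ : ℕ, ∀ N : ℕ, N₀ ≤ N → ∀ s ∈ Icc (0 : ℝ) 0, ∀ x : T3,
      MemLp (fun z => empiricalDensityField ((Φ N).flow s z) (fun y => φ N (y - x))) 2 (localGibbsLaw σ a₀ u₀ θ₀ N (Φ N)) ∧
        variance (fun z => empiricalDensityField ((Φ N).flow s z) (fun y => φ N (y - x)))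
          (localGibbsLaw σ a₀ u₀ θ₀ N (Φ N)) ≤ A * ((N : ℝ) + 1) ^ (3 * γ - 1) := by
    refine ⟨A, N₀, fun N hN s hs x => ?_⟩
    obtain rfl : s = 0 := le_antisymm hs.2 hs.1
    exact hAN N hN x
  obtain ⟨A', N₁, h⟩ := pairCorrelation_of_mesoVariance σ a₀ θ₀ u₀ Φ 0 hσ hσ2 hprof γ C φ hγ hadm hV
  exact ⟨A', N₁, fun N hN x => h N hN 0 ⟨le_rfl, le_rfl⟩ x⟩

end Summit.AtomisticToContinuum.HydrodynamicLimit.Theorems.MesoChebyshevWindow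

end
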